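import Literature.NumberTheory.EllipticCurves.PointCountHasseInvariantProofs
import Literature.NumberTheory.EllipticCurves.FormalGroupHasseInvariantProofs
import Literature.NumberTheory.EllipticCurves.TorsionCardinality
import Mathlib.Algebra.Polynomial.Expand
import Mathlib.FieldTheory.IsAlgClosed.AlgebraicClosure
import Mathlib.RingTheory.LocalRing.ResidueField.Basic
import HarnessLib

/-!
# The `p`-division polynomial of a supersingular curve is a non-zero constant

`Proofs` file (theorems only, no definitions, no named facts), topic `NumberTheory/EllipticCurves`.
Let `p` be an odd prime and `W` an elliptic curve over a finite field `k` of characteristic `p`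
whose Hasse invariant `A_p(W)` (`WeierstrassCurve.hasseCoeff W p`, the coefficient of `x^{p-1}`
in `Ψ₂²(x)^{(p-1)/2}`, Silverman *AEC* V.4.1(a)) vanishes — a **supersingular** curve.  Then:

* `WeierstrassCurve.hasseCoeff_prime_pow_succ` — over any ring of characteristic `p`,
  **`A_{p^{r+1}} = A_{p^r} · A_p^{p^r}`** (`A_q` = coefficient of `x^{q-1}` in `Ψ₂²^{(q-1)/2}`;
  Silverman, proof of V.4.1(a)); hence `A_p = 0 ⇒ A_{p^r} = 0` (`hasseCoeff_prime_pow_eq_zero`);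
* `WeierstrassCurve.natCard_point_modEq_one_of_hasseCoeff_eq_zero` — **`#W(k) ≡ 1 (mod p)`**
  (from the tree's `cast_natCard_point_eq`: `#W(𝔽_q) = 1 - A_q` in `𝔽_q`), so `W(k)` has no point
  of order `p`, and neither has `W(L)` for any algebraic extension `L/k` (a point is defined over a
  finite subfield): `eq_zero_of_prime_zsmul_eq_zero_of_hasseCoeff_eq_zero`;
* `WeierstrassCurve.exists_ΨSq_prime_eq_C_of_hasseCoeff_eq_zero`,
  `WeierstrassCurve.exists_preΨ'_prime_eq_C_of_hasseCoeff_eq_zero` — **`ΨSq_p = ψ_p²` and `ψ_p`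
  are non-zero constants** (over `k̄` every `a` is the abscissa of a point, which would be a
  point of order `p` if `ΨSq_p(a) = 0`, by the tree's `zsmul_some_eq_zero_iff_eval_ΨSq`); this is
  the division-polynomial criterion for supersingularity (Debry 2014; `[p]` purely inseparable);
* `WeierstrassCurve.coeff_preΨ'_prime_of_hasseCoeff_mem_maximalIdeal` — for a Weierstrass
  equation `M` over a local ring with finite residue field of characteristic `p`, with unit
  discriminant and `A_p(M)` in the maximal ideal (**good supersingular reduction**), the constant
  coefficient of `ψ_p(M) = preΨ'_p` is a unit and all other coefficients lie in the maximal
  ideal.  With the leading coefficient `p` of `ψ_p` (Mathlib `coeff_preΨ'`) this is the shape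
  `ψ_p = p x^{(p²-1)/2} + 𝔪(…) + unit` behind the valuation `|x(P)| = |p|^{-2/(p²-1)}` of the
  `p`-torsion at an unramified supersingular place (Serre 1972, §1.11, Prop. 12; sequel file).

## References

* [SilvermanAEC2009] J. H. Silverman, *The Arithmetic of Elliptic Curves*, 2nd ed. (2009),
  Thm. V.4.1(a) and its proof, V.3.1(a), Exercise 3.7.
* [Serre1972] J.-P. Serre, Invent. Math. 15 (1972), §1.11.
* C. Debry, J. Théor. Nombres Bordeaux 26 (2014) 595–605 (supersingularity and `ψ_p`).
-/

noncomputable section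

open scoped Classical
open Polynomial

namespace WeierstrassCurve

/-! ## `A_{p^{r+1}} = A_{p^r} · A_p^{p^r}` in characteristic `p` -/

section CharP

variable {R : Type*} [CommRing R] (W : WeierstrassCurve R) (p : ℕ) [hp : Fact p.Prime] [CharP R p]

/-- **`A_{p^{r+1}} = A_{p^r} · A_p^{p^r}`** for the coefficients `A_q = [x^{q-1}] Ψ₂²(x)^{(q-1)/2}`
of a Weierstrass equation over a ring of odd prime characteristic `p`:
`Ψ₂²^{(p^{r+1}-1)/2} = Ψ₂²^{(p^r-1)/2} · (Ψ₂²^{(p-1)/2})^{p^r}`, the second factor has only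
exponents divisible by `p^r` (Frobenius), and in degree `p^{r+1} - 1` only
`x^{p^r-1} · x^{p^r(p-1)}` contributes, `deg Ψ₂²^{(p^r-1)/2} ≤ 3(p^r-1)/2 < 2p^r - 1`.
[cite: SilvermanAEC2009, V.4.1 (proof)] -/
theorem hasseCoeff_prime_pow_succ (hp2 : p ≠ 2) (r : ℕ) :
    W.hasseCoeff (p ^ (r + 1)) = W.hasseCoeff (p ^ r) * W.hasseCoeff p ^ p ^ r := by
  obtain ⟨k, hk⟩ : Odd p := hp.out.odd_of_ne_two hp2
  obtain ⟨a, ha⟩ : Odd (p ^ r) := (hp.out.odd_of_ne_two hp2).pow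
  obtain ⟨m, hm⟩ : ∃ m, (2 * a + 1) * k = m := ⟨_, rfl⟩
  set f : R[X] := W.twoTorsionPolynomial.toPoly with hf
  have hdef : ∀ q, W.hasseCoeff q = (f ^ ((q - 1) / 2)).coeff (q - 1) := fun q ↦ rfl
  have hpr0 : 0 < p ^ r := pow_pos hp.out.pos r
  -- exponents
  have hN : p ^ (r + 1) = 2 * (a + m) + 1 := by
    rw [pow_succ, ha, hk, ← hm]; ring
  have hN1 : p ^ (r + 1) - 1 = 2 * a + 2 * m := by omega
  have hN2 : (p ^ (r + 1) - 1) / 2 = a + m := by omega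
  have h2m : 2 * m = (2 * a + 1) * (2 * k) := by rw [← hm]; ring
  have hAr : W.hasseCoeff (p ^ r) = (f ^ a).coeff (2 * a) := by
    rw [hdef, show (p ^ r - 1) / 2 = a by omega, show p ^ r - 1 = 2 * a by omega]
  have hA1 : W.hasseCoeff p = (f ^ k).coeff (2 * k) := by
    rw [hdef, show (p - 1) / 2 = k by omega, show p - 1 = 2 * k by omega]
  -- the Frobenius factor
  set G : R[X] := (f ^ k) ^ (2 * a + 1) with hG
  have hGexp : G = Polynomial.map (iterateFrobenius R p r) (expand R (p ^ r) (f ^ k)) := by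
    rw [hG, ← ha, map_iterateFrobenius_expand]
  have hGcoeff : ∀ j, G.coeff j =
      if p ^ r ∣ j then ((f ^ k).coeff (j / p ^ r)) ^ p ^ r else 0 := by
    intro j
    rw [hGexp, coeff_map, coeff_expand hpr0]
    split_ifs with h
    · rw [iterateFrobenius_def]
    · rw [map_zero]
  have h3 : f.natDegree ≤ 3 := by rw [hf, Cubic.toPoly]; exact natDegree_cubic_le
  have hdeg : (f ^ a).natDegree ≤ 3 * a :=
    calc (f ^ a).natDegree ≤ a * f.natDegree := natDegree_pow_le
      _ ≤ a * 3 := Nat.mul_le_mul_left a h3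
      _ = 3 * a := mul_comm _ _
  have hsplit : f ^ (a + m) = f ^ a * G := by rw [pow_add, ← hm, pow_mul']
  -- expand the product
  rw [hdef, hN2, hN1, hsplit, coeff_mul, Finset.sum_eq_single (2 * a, 2 * m)]
  · -- the main term
    have hdvd : p ^ r ∣ 2 * m := ⟨2 * k, by rw [ha, h2m]⟩
    rw [hGcoeff, if_pos hdvd, hAr, hA1, ha, h2m, Nat.mul_div_cancel_left _ (by omega)]
  · -- the other terms vanish
    rintro ⟨i, j⟩ hij hne
    rw [Finset.mem_antidiagonal] at hij
    change i + j = 2 * a + 2 * m at hij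
    change (f ^ a).coeff i * G.coeff j = 0
    rw [hGcoeff]
    split_ifs with hdvd
    · obtain ⟨t, rfl⟩ := hdvd
      rw [ha] at hij hne
      rcases lt_trichotomy t (2 * k) with hlt | rfl | hgt
      · -- `t < 2k`: then `i ≥ 4a + 1 > deg f^a`
        have h1 : (2 * a + 1) * (t + 1) ≤ (2 * a + 1) * (2 * k) := Nat.mul_le_mul_left _ hlt
        have hi : 3 * a < i := by nlinarith
        rw [coeff_eq_zero_of_natDegree_lt (hdeg.trans_lt hi), zero_mul]
      · rw [← h2m] at hij hne
        exact (hne (Prod.ext (Nat.add_right_cancel hij) rfl)).elim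
      · -- `t > 2k`: impossible
        have h1 : (2 * a + 1) * (2 * k + 1) ≤ (2 * a + 1) * t := Nat.mul_le_mul_left _ hgt
        exfalso
        nlinarith
    · rw [mul_zero]
  · intro h
    exact (h (Finset.mem_antidiagonal.mpr rfl)).elim

/-- `A_p = 0 ⇒ A_{p^r} = 0` for every `r ≥ 1` (odd prime characteristic `p`).
[cite: SilvermanAEC2009, V.4.1 (proof)] -/
theorem hasseCoeff_prime_pow_eq_zero (hp2 : p ≠ 2) (hA : W.hasseCoeff p = 0) {r : ℕ}
    (hr : 0 < r) : W.hasseCoeff (p ^ r) = 0 := by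
  obtain ⟨s, rfl⟩ : ∃ s, r = s + 1 := ⟨r - 1, by omega⟩
  rw [hasseCoeff_prime_pow_succ W p hp2, hA, zero_pow (pow_ne_zero _ hp.out.ne_zero), mul_zero]

end CharP

/-! ## Finite fields: `#W(k) ≡ 1 (mod p)`, no point of order `p` -/

section Finite

variable {K : Type*} [Field K] [Fintype K] (W : WeierstrassCurve K) (p : ℕ) [hp : Fact p.Prime]
  [CharP K p]

/-- **`#W(k) ≡ 1 (mod p)` for a supersingular elliptic curve over a finite field `k` of odd
characteristic `p`**: `#W(k) = 1 - A_q` in `k` (`cast_natCard_point_eq`, *AEC* V.4.1(a)) and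
`A_q = 0` (`hasseCoeff_prime_pow_eq_zero`). [cite: SilvermanAEC2009, V.4.1] -/
theorem natCard_point_modEq_one_of_hasseCoeff_eq_zero [W.IsElliptic] (hp2 : p ≠ 2)
    (hA : W.hasseCoeff p = 0) : Nat.card W.toAffine.Point ≡ 1 [MOD p] := by
  obtain ⟨n, -, hn⟩ := FiniteField.card K p
  have h2 : ringChar K ≠ 2 := by rw [ringChar.eq K p]; exact hp2
  have hq : W.hasseCoeff (Fintype.card K) = 0 := by
    rw [hn]
    exact hasseCoeff_prime_pow_eq_zero W p hp2 hA n.pos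
  have hcast : (Nat.card W.toAffine.Point : K) = ((1 : ℕ) : K) := by
    rw [W.cast_natCard_point_eq h2, Nat.cast_one]
    change (1 : K) - W.hasseCoeff (Fintype.card K) = 1
    rw [hq, sub_zero]
  exact (CharP.natCast_eq_natCast K p).mp hcast

/-- A supersingular elliptic curve over a finite field of odd characteristic `p` has **no rational
point of order `p`**. [cite: SilvermanAEC2009, V.3.1(a) and V.4.1] -/
theorem eq_zero_of_prime_nsmul_eq_zero_of_hasseCoeff_eq_zero [DecidableEq K] [W.IsElliptic]
    (hp2 : p ≠ 2) (hA : W.hasseCoeff p = 0) (P : W.toAffine.Point) (hP : p • P = 0) :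
    P = 0 := by
  by_contra hP0
  have hord : addOrderOf P = p := addOrderOf_eq_prime hP hP0
  have hdvd : p ∣ Nat.card W.toAffine.Point := hord ▸ addOrderOf_dvd_natCard P
  have h1 : Nat.card W.toAffine.Point % p = 1 % p :=
    natCard_point_modEq_one_of_hasseCoeff_eq_zero W p hp2 hA
  rw [Nat.mod_eq_zero_of_dvd hdvd, Nat.mod_eq_of_lt hp.out.one_lt] at h1
  exact zero_ne_one h1

end Finite

/-! ## Algebraic extensions of a finite field: no point of order `p` -/

section Algebraic

variable {K : Type*} [Field K] [Fintype K] (W : WeierstrassCurve K) (p : ℕ) [hp : Fact p.Prime]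
  [CharP K p]

/-- Over **any algebraic extension `L`** of the finite field `k`, a supersingular elliptic curve
`W/k` (odd characteristic `p`, `A_p(W) = 0`) has no `L`-point of order `p`: an affine point
`(x, y)` is defined over the finite field `k(x, y)`, where `eq_zero_of_prime_nsmul_eq_zero_of_hasseCoeff_eq_zero`
applies (`A_p` commutes with base change). [cite: SilvermanAEC2009, V.3.1(a)] -/
theorem eq_zero_of_prime_zsmul_eq_zero_of_hasseCoeff_eq_zero [W.IsElliptic] (hp2 : p ≠ 2)
    (hA : W.hasseCoeff p = 0) {L : Type*} [Field L] [Algebra K L] [Algebra.IsAlgebraic K L]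
    (P : (W.baseChange L).toAffine.Point) (hP : (p : ℤ) • P = 0) : P = 0 := by
  rcases P with _ | ⟨x, y, h⟩
  · rfl
  exfalso
  -- the finite field `k(x, y)`
  set K' : IntermediateField K L := IntermediateField.adjoin K {x, y} with hK'
  haveI : FiniteDimensional K K' :=
    IntermediateField.finiteDimensional_adjoin fun z _ ↦ (Algebra.IsAlgebraic.isAlgebraic z).isIntegral
  haveI : Finite K' := Module.finite_of_finite K
  letI : Fintype K' := Fintype.ofFinite K'
  haveI : CharP K' p := charP_of_injective_algebraMap (algebraMap K K').injective p
  have hx : x ∈ K' := IntermediateField.subset_adjoin K _ (Set.mem_insert x {y})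
  have hy : y ∈ K' := IntermediateField.subset_adjoin K _ (Set.mem_insert_of_mem x rfl)
  set f : K' →ₐ[K] L := K'.val with hf
  -- the point over `K'`
  have h' : (W.baseChange K').toAffine.Nonsingular ⟨x, hx⟩ ⟨y, hy⟩ := by
    have := (W.toAffine.baseChange_nonsingular (f := f) f.injective ⟨x, hx⟩ ⟨y, hy⟩).mp
    exact this h
  set P' : (W.baseChange K').toAffine.Point := .some _ _ h' with hP'
  have hmap : Affine.Point.map f P' = .some x y h := by
    rw [hP', Affine.Point.map_some]
    rfl
  have hP'0 : (p : ℤ) • P' = 0 := by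
    apply Affine.Point.map_injective (f := f)
    rw [map_zsmul, hmap, hP, map_zero]
  have hA' : (W.baseChange K').hasseCoeff p = 0 := by
    rw [baseChange, map_hasseCoeff, hA, map_zero]
  have hp' : p • P' = 0 := by rw [← natCast_zsmul]; exact hP'0
  have := eq_zero_of_prime_nsmul_eq_zero_of_hasseCoeff_eq_zero (W.baseChange K') p hp2 hA' P' hp'
  exact Affine.Point.some_ne_zero _ this

/-! ## The `p`-division polynomial is a non-zero constant -/

/-- **`ΨSq_p = ψ_p²` of a supersingular elliptic curve over a finite field is a non-zero
constant** (odd `p`): over `k̄` every `a` is the abscissa of a point `(a, b)`, and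
`ΨSq_p(a) = 0 ↔ p • (a, b) = O` (`zsmul_some_eq_zero_iff_eval_ΨSq`) would make it a point of
order `p`; so `ΨSq_p` has no root in `k̄`, and is not zero. [cite: SilvermanAEC2009, Exercise 3.7(f) and V.3.1(a)] -/
theorem exists_ΨSq_prime_eq_C_of_hasseCoeff_eq_zero [W.IsElliptic] (hp2 : p ≠ 2)
    (hA : W.hasseCoeff p = 0) : ∃ c : K, c ≠ 0 ∧ W.ΨSq p = C c := by
  set L := AlgebraicClosure K
  set E := W.baseChange L with hE
  -- no root over `k̄`, and not the zero polynomial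
  have key : ∀ a : L, (E.ΨSq p).eval a ≠ 0 := by
    intro a h0
    obtain ⟨b, hab⟩ := E.exists_equation a
    have hns : E.toAffine.Nonsingular a b := Affine.equation_iff_nonsingular.mp hab
    have hP : (p : ℤ) • (Affine.Point.some a b hns : E.toAffine.Point) = 0 :=
      (E.zsmul_some_eq_zero_iff_eval_ΨSq hns p).mpr h0
    exact Affine.Point.some_ne_zero _
      (eq_zero_of_prime_zsmul_eq_zero_of_hasseCoeff_eq_zero W p hp2 hA _ hP)
  have hEmap : E.ΨSq p = (W.ΨSq p).map (algebraMap K L) := by rw [hE, baseChange, map_ΨSq]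
  have hdeg : (E.ΨSq p).degree = 0 := by
    by_contra hne
    obtain ⟨a, ha⟩ := IsAlgClosed.exists_root (E.ΨSq p) hne
    exact key a ha
  have hdegK : (W.ΨSq p).degree = 0 := by
    rwa [hEmap, degree_map_eq_of_injective (algebraMap K L).injective] at hdeg
  refine ⟨(W.ΨSq p).coeff 0, fun h0 ↦ ?_, eq_C_of_degree_eq_zero hdegK⟩
  have hzero : W.ΨSq p = 0 := by
    rw [eq_C_of_degree_eq_zero hdegK, h0, map_zero]
  apply key 0
  rw [hEmap, hzero, Polynomial.map_zero, eval_zero]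

/-- **`ψ_p = preΨ'_p` of a supersingular elliptic curve over a finite field is a non-zero
constant** (odd `p`; `ΨSq_p = (preΨ'_p)²`). [cite: SilvermanAEC2009, Exercise 3.7 and V.3.1(a)] -/
theorem exists_preΨ'_prime_eq_C_of_hasseCoeff_eq_zero [W.IsElliptic] (hp2 : p ≠ 2)
    (hA : W.hasseCoeff p = 0) : ∃ c : K, c ≠ 0 ∧ W.preΨ' p = C c := by
  obtain ⟨c, hc, hΨ⟩ := exists_ΨSq_prime_eq_C_of_hasseCoeff_eq_zero W p hp2 hA
  have hodd : ¬ Even p := Nat.not_even_iff_odd.mpr (hp.out.odd_of_ne_two hp2)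
  have hsq : W.preΨ' p ^ 2 = C c := by
    have := W.ΨSq_ofNat p
    rw [if_neg hodd, mul_one] at this
    rw [← this, hΨ]
  have hdeg : (W.preΨ' p).natDegree = 0 := by
    have := congrArg natDegree hsq
    rw [natDegree_pow, natDegree_C] at this
    omega
  refine ⟨(W.preΨ' p).coeff 0, fun h0 ↦ hc ?_, eq_C_of_natDegree_eq_zero hdeg⟩
  have hzero : W.preΨ' p = 0 := by rw [eq_C_of_natDegree_eq_zero hdeg, h0, map_zero]
  have := hsq
  rw [hzero, zero_pow two_ne_zero] at this
  have h := congrArg (coeff · 0) this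
  simp only [coeff_zero, coeff_C_zero] at h
  exact h.symm

end Algebraic

/-! ## Good supersingular reduction: the shape of `ψ_p` over a local ring -/

/-- **The shape of `ψ_p` at a place of good supersingular reduction.**  Let `M` be a
Weierstrass equation over a local ring `R` whose residue field is finite of odd characteristic
`p`, with `Δ(M) ∈ Rˣ` and `A_p(M)` in the maximal ideal.  Then the constant coefficient of
`preΨ'_p(M)` is a unit and every other coefficient lies in the maximal ideal (the reduction of
`preΨ'_p(M)` is `preΨ'_p` of the supersingular elliptic curve `M mod 𝔪`, a non-zero constant).
[cite: SilvermanAEC2009, V.3.1(a), V.4.1(a)] [cite: Serre1972, §1.11] -/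
theorem coeff_preΨ'_prime_of_hasseCoeff_mem_maximalIdeal {R : Type*} [CommRing R]
    [IsLocalRing R] [Finite (IsLocalRing.ResidueField R)] (p : ℕ) [hp : Fact p.Prime]
    [CharP (IsLocalRing.ResidueField R) p] (hp2 : p ≠ 2) (M : WeierstrassCurve R)
    (hΔ : IsUnit M.Δ) (hA : M.hasseCoeff p ∈ IsLocalRing.maximalIdeal R) :
    IsUnit ((M.preΨ' p).coeff 0) ∧
      ∀ i, 0 < i → (M.preΨ' p).coeff i ∈ IsLocalRing.maximalIdeal R := by
  letI : Fintype (IsLocalRing.ResidueField R) := Fintype.ofFinite _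
  set res := IsLocalRing.residue R with hres
  set W := M.map res with hW
  haveI : W.IsElliptic := by
    rw [isElliptic_iff, hW, map_Δ]
    exact hΔ.map res
  have hA' : W.hasseCoeff p = 0 := by
    rw [hW, map_hasseCoeff, hres, IsLocalRing.residue_eq_zero_iff]
    exact hA
  obtain ⟨c, hc, hΨ⟩ := exists_preΨ'_prime_eq_C_of_hasseCoeff_eq_zero W p hp2 hA'
  have hmap : (M.preΨ' p).map res = C c := by rw [← map_preΨ', ← hW, hΨ]
  have hcoeff : ∀ i, res ((M.preΨ' p).coeff i) = (C c : (IsLocalRing.ResidueField R)[X]).coeff i :=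
    fun i ↦ by rw [← hmap, coeff_map]
  refine ⟨?_, fun i hi ↦ ?_⟩
  · rw [← IsLocalRing.residue_ne_zero_iff_isUnit, ← hres, hcoeff 0, coeff_C_zero]
    exact hc
  · rw [← IsLocalRing.residue_eq_zero_iff, ← hres, hcoeff i, coeff_C, if_neg hi.ne']

end WeierstrassCurve

end
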